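import Summits.QuantumAdvantage.QuantumAdvantage.Theorems.ArithStatLadderIqThreeNotPPolyApexMinFac
import Literature.Computability.Complexity.AdaptiveQueries
import Literature.Computability.Complexity.AdaptiveBPPSimulation
import Literature.Computability.Complexity.PPolyTuringClosure
import Literature.Computability.Complexity.CircuitClassesUniformProofs
import Literature.Computability.Complexity.IntPairBricks
import Literature.Computability.Complexity.ZIntBricks
import Literature.Computability.Complexity.FoldBricks
import Literature.Computability.Complexity.TautCertificates
import Summits.QuantumAdvantage.QuantumAdvantage.Theses.CircuitLB
import Summits.QuantumAdvantage.QuantumAdvantage.Theses.Shor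

/-!
# Crux `ArithStatLadder.IqThreeNotPPoly` (stmt-QuantumAdvantage-2422), line `Sketch` — the apex sits ABOVE factoring, II:
# `SQUAREFREES ≤ᵀₚ FACT`, hence `SQF ∉ P/poly ⇒ FACT ∉ P/poly` and `SQF ∉ BPP ⇒ FACT ∉ BPP`

Continuation lead `prover-line-stmt-QuantumAdvantage-2422-c4-0`, second file (on top of
`ArithStatLadderIqThreeNotPPolyApexMinFac.lean`: `exists_minFac_adPres`, the least prime factor by binary
search over the `FACT` oracle as a presented adaptive program).

* `exists_squarefree_adPres` — squarefreeness as a presented adaptive program over `FACT`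
  (`AdQuery.AdPres`): `|bin N| + 1` clocked rounds (`AdPres.iterate_of_growth`) peeling the least prime
  factor `p` off the current cofactor `M` and clearing a flag when `p² ∣ M` (`peel_invariant`:
  `Squarefree N ↔ flag ∧ Squarefree M`, `M·2^k ≤ N`; `squarefree_iff_minFac_peel`).
* `exists_adLang_eq_squarefree`, `squarefree_polyTimeTuringReducible_FACT` — **`SQF ≤ᵀₚ FACT`**: the
  language of squarefree numerals is a bounded adaptive reduction `adLang Q q D FACT` (`Q ∈ FP`, `D ∈ P`:
  the program's final test ANDed with "the input is a nonempty canonical numeral"), hence in `P^{FACT}`.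
* `squarefree_mem_PPoly_of_FACT_mem_PPoly` (`P^{P/poly} ⊆ P/poly`, `PRel_ofLanguage_subset_PPoly`) and
  `squarefree_mem_BPP_of_FACT_mem_BPP` (`P^{BPP} = BPP`, `AdBPPSim.adLang_mem_BPP`).
* BY NAME: `clbFactNotPpoly_of_squarefree_not_mem_PPoly : SQF ∉ P/poly → CircuitLB.ClbFactNotPpoly` and
  `shorThesis_of_squarefree_not_mem_BPP : SQF ∉ BPP → Shor.ShorThesis` — the squarefree apexes of the
  lines for cruxes 2422 (`stub_sqfreeNotPPoly`) and 14864 (`stub_sqfreeNotBPP`) are AT LEAST AS STRONG AS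
  the theses of the factoring routes (and close the summit by themselves, `…ApexBQP.lean`): as far as
  the summit is concerned these lines are dominated by route Shor.

Theorems only; no definition (programs are built inside proofs from the tree's `FP` bricks).
-/

set_option linter.dupNamespace false -- D-0017: single-problem summit ⇒ `QuantumAdvantage.QuantumAdvantage` by design

noncomputable section

namespace Summit.QuantumAdvantage.QuantumAdvantage.Theorems.IqThreeNotPPoly

open _root_.Computability Polynomial Literature.Computability.Complexity
open Literature.Computability.Complexity.Brick Literature.Computability.Complexity.Plumb
open Literature.Computability.Complexity.AdQuery
open Literature.Computability.QuantumComplexity (FACT)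

/-! ### Arithmetic of one peeling round (oracle-free) -/

/-- **Peeling the least prime factor**: for `M ≥ 2` with `p = minFac M`, `M` is squarefree iff
`p² ∤ M` and `M / p` is squarefree. [folklore] -/
theorem squarefree_iff_minFac_peel {M : ℕ} (hM : 2 ≤ M) :
    Squarefree M ↔ ¬ (M % (M.minFac * M.minFac) = 0) ∧ Squarefree (M / M.minFac) := by
  have hp : M.minFac.Prime := Nat.minFac_prime (by omega)
  have hdvd : M.minFac ∣ M := Nat.minFac_dvd M
  have hM' : M = M.minFac * (M / M.minFac) := (Nat.mul_div_cancel' hdvd).symm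
  rw [← Nat.dvd_iff_mod_eq_zero]
  constructor
  · intro hs
    have h2 : ¬ M.minFac * M.minFac ∣ M := fun h =>
      hp.one_lt.ne' (Nat.isUnit_iff.1 (hs M.minFac h))
    refine ⟨h2, ?_⟩
    rw [hM'] at hs
    exact Squarefree.of_mul_right hs
  · rintro ⟨h2, hs⟩
    have hcop : Nat.Coprime M.minFac (M / M.minFac) := by
      rw [Nat.Prime.coprime_iff_not_dvd hp]
      intro h
      have h' : M.minFac * M.minFac ∣ M.minFac * (M / M.minFac) := Nat.mul_dvd_mul_left _ h
      rw [← hM'] at h'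
      exact h2 h'
    rw [hM', Nat.squarefree_mul hcop]
    exact ⟨hp.squarefree, hs⟩

/-- **Peeling invariant.** If `F` performs one round `⟨x, ⟨bin M, [b]⟩⟩ ↦ ⟨x, ⟨bin (M / p), [b ∧ p² ∤ M]⟩⟩`
(`p = minFac M`) on states with `2 ≤ M ≤ N` and fixes the states with `M ≤ 1`, then after `k` rounds
from `⟨x, ⟨bin N, [1]⟩⟩` the state is `⟨x, ⟨bin M, [b]⟩⟩` with `1 ≤ M ≤ N`,
`Squarefree N ↔ (b ∧ Squarefree M)`, and `M = 1` or `M·2^k ≤ N`. [folklore] -/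
theorem peel_invariant (F : List Bool → List Bool) (x : List Bool) {N : ℕ} (hN : 1 ≤ N)
    (hstep : ∀ (M : ℕ) (b : Bool), 2 ≤ M → M ≤ N →
      F (boolPair x (boolPair (encodeNat M) [b])) =
        boolPair x (boolPair (encodeNat (M / M.minFac))
          [b && !decide (M % (M.minFac * M.minFac) = 0)]))
    (hstay : ∀ (M : ℕ) (b : Bool), M ≤ 1 →
      F (boolPair x (boolPair (encodeNat M) [b])) = boolPair x (boolPair (encodeNat M) [b]))
    (k : ℕ) : ∃ (M : ℕ) (b : Bool),
      F^[k] (boolPair x (boolPair (encodeNat N) [true])) = boolPair x (boolPair (encodeNat M) [b]) ∧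
      1 ≤ M ∧ M ≤ N ∧ (Squarefree N ↔ (b = true ∧ Squarefree M)) ∧ (M = 1 ∨ M * 2 ^ k ≤ N) := by
  induction k with
  | zero => exact ⟨N, true, rfl, hN, le_rfl, by simp, Or.inr (by simp)⟩
  | succ k ih =>
    obtain ⟨M, b, hk, h1, hMN, hiff, hbound⟩ := ih
    rw [Function.iterate_succ_apply', hk]
    by_cases hM : 2 ≤ M
    · rw [hstep M b hM hMN]
      have hp : M.minFac.Prime := Nat.minFac_prime (by omega)
      have hdvd : M.minFac ∣ M := Nat.minFac_dvd M
      have hM' : M / M.minFac * M.minFac = M := Nat.div_mul_cancel hdvd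
      have hpos : 1 ≤ M / M.minFac := by
        rcases Nat.eq_zero_or_pos (M / M.minFac) with h | h
        · rw [h, zero_mul] at hM'; omega
        · exact h
      refine ⟨M / M.minFac, b && !decide (M % (M.minFac * M.minFac) = 0), rfl, hpos,
        (Nat.div_le_self _ _).trans hMN, ?_, Or.inr ?_⟩
      · rw [hiff, squarefree_iff_minFac_peel hM, Bool.and_eq_true, Bool.not_eq_true',
          decide_eq_false_iff_not]
        tauto
      · have h2 := hp.two_le
        rcases hbound with rfl | hb
        · omega
        · calc M / M.minFac * 2 ^ (k + 1) = M / M.minFac * 2 * 2 ^ k := by ring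
            _ ≤ M / M.minFac * M.minFac * 2 ^ k :=
              Nat.mul_le_mul_right _ (Nat.mul_le_mul_left _ h2)
            _ = M * 2 ^ k := by rw [hM']
            _ ≤ N := hb
    · rw [hstay M b (by omega)]
      exact ⟨M, b, rfl, h1, hMN, hiff, Or.inl (by omega)⟩

/-- After `|bin N| + 1` rounds only `M = 1` is possible. [folklore] -/
theorem peel_final {N M : ℕ} (h1 : 1 ≤ M) (hbound : M = 1 ∨ M * 2 ^ ((encodeNat N).length + 1) ≤ N) :
    M = 1 := by
  rcases hbound with h | h
  · exact h
  · have hlt : N < 2 ^ (encodeNat N).length := by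
      have h' := bitsToNat_lt (encodeNat N); rwa [bitsToNat_encodeNat] at h'
    have h2 : 2 ^ (encodeNat N).length ≤ M * 2 ^ ((encodeNat N).length + 1) :=
      calc 2 ^ (encodeNat N).length ≤ 2 ^ ((encodeNat N).length + 1) :=
            Nat.pow_le_pow_right (by norm_num) (by omega)
        _ = 1 * 2 ^ ((encodeNat N).length + 1) := (one_mul _).symm
        _ ≤ M * 2 ^ ((encodeNat N).length + 1) := Nat.mul_le_mul_right _ h1
    omega

/-! ### The presented squarefreeness test `bin N ↦ [Squarefree N]` -/

/-- **Squarefreeness is decided by a presented adaptive program over `FACT`**: some `sq` with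
`AdPres FACT sq` has `sq (bin N) = [Squarefree N]` for every `N ≥ 1`. Program: initialise
`⟨bin N, ⟨bin N, [1]⟩⟩`; run `|bin N| + 1` clocked rounds of the presented peeling round — read the
least prime factor `p` of the current cofactor `M ≥ 2` off the `minFac` subroutine
(`exists_minFac_adPres`), replace `M` by `M / p` and clear the flag if `p² ∣ M` (second component
clipped to `2|bin N| + 3` symbols for linear growth); output the flag. [folklore] -/
theorem exists_squarefree_adPres : ∃ sq : List Bool → List Bool, AdPres FACT sq ∧
    ∀ N : ℕ, 1 ≤ N → sq (encodeNat N) = [decide (Squarefree N)] := by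
  obtain ⟨mf, hmf, hmfval⟩ := exists_minFac_adPres
  -- state `T = ⟨x, ⟨cur, flag⟩⟩`; `U T = ⟨T, mf cur⟩`; the new second component is computed from `U T`
  let CUR : List Bool → List Bool := fstF ∘ sndF
  let FLG : List Bool → List Bool := sndF ∘ sndF
  let U : List Bool → List Bool := fanoutFn (fun w => w) (mf ∘ CUR)
  let CUR' : List Bool → List Bool := CUR ∘ fstF
  let NEWCUR : List Bool → List Bool := divFn ∘ fanoutFn CUR' sndF
  let DIVTEST : List Bool → List Bool := isNilFn ∘ remFn ∘ fanoutFn CUR' (prodFn ∘ fanoutFn sndF sndF)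
  let NEWFLG : List Bool → List Bool := andFn (FLG ∘ fstF) (notFn DIVTEST)
  let POST : List Bool → List Bool := fanoutFn NEWCUR NEWFLG
  let SEC : List Bool → List Bool := iteFn (valGeTwoFn ∘ CUR) (POST ∘ U) sndF
  let CLIP : List Bool → List Bool := takeFn ∘ fanoutFn (polyFn (2 * X + 3) ∘ fstF) SEC
  let F : List Bool → List Bool := fanoutFn fstF CLIP
  have hCUR : CUR ∈ FP := comp_mem_FP fstF_mem_FP sndF_mem_FP
  have hFLG : FLG ∈ FP := comp_mem_FP sndF_mem_FP sndF_mem_FP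
  have hU : AdPres FACT U := AdPres.fanout AdPres.id (AdPres.comp hmf (AdPres.of_mem_FP hCUR))
  have hCUR' : CUR' ∈ FP := comp_mem_FP hCUR fstF_mem_FP
  have hNEWCUR : NEWCUR ∈ FP := comp_mem_FP divFn_mem_FP (fanoutFn_mem_FP hCUR' sndF_mem_FP)
  have hDIVTEST : DIVTEST ∈ FP := comp_mem_FP isNilFn_mem_FP (comp_mem_FP remFn_mem_FP
    (fanoutFn_mem_FP hCUR' (comp_mem_FP prodFn_mem_FP (fanoutFn_mem_FP sndF_mem_FP sndF_mem_FP))))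
  have hNEWFLG : NEWFLG ∈ FP := andFn_mem_FP (comp_mem_FP hFLG fstF_mem_FP) (notFn_mem_FP hDIVTEST)
  have hPOST : POST ∈ FP := fanoutFn_mem_FP hNEWCUR hNEWFLG
  have hSEC : AdPres FACT SEC := AdPres.ite (AdPres.of_mem_FP (comp_mem_FP valGeTwoFn_mem_FP hCUR))
    (AdPres.FP_comp hU hPOST) (AdPres.of_mem_FP sndF_mem_FP)
  have hCLIP : AdPres FACT CLIP :=
    AdPres.FP_comp (AdPres.fanout (AdPres.of_mem_FP (comp_mem_FP (polyFn_mem_FP _) fstF_mem_FP)) hSEC)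
      takeFn_mem_FP
  have hF : AdPres FACT F := AdPres.fanout (AdPres.of_mem_FP fstF_mem_FP) hCLIP
  -- growth and first-field preservation on EVERY word
  have hfst : ∀ w, fstF (F w) = fstF w := fun w => by simp [F]
  have hgrowth : ∀ w, (F w).length ≤ w.length + 5 * ((fstF w).length + 1) := by
    intro w
    have hclip : (CLIP w).length ≤ 2 * (fstF w).length + 3 := by
      simp only [CLIP, Function.comp_apply, fanoutFn_apply, takeFn_boolPair, polyFn_apply,
        List.length_take, List.length_replicate, eval_add, eval_mul, eval_ofNat, eval_X]
      exact min_le_left _ _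
    simp only [F, fanoutFn_apply, length_boolPair]
    nlinarith [hclip]
  -- values of one round on a well-formed state `T = ⟨bin N, ⟨bin M, [b]⟩⟩`, `M ≤ N`
  have hround : ∀ N : ℕ, ∀ (M : ℕ) (b : Bool), M ≤ N →
      F (boolPair (encodeNat N) (boolPair (encodeNat M) [b])) =
        boolPair (encodeNat N) (if 2 ≤ M then
          boolPair (encodeNat (M / M.minFac)) [b && !decide (M % (M.minFac * M.minFac) = 0)]
          else boolPair (encodeNat M) [b]) := by
    intro N M b hMN
    set T := boolPair (encodeNat N) (boolPair (encodeNat M) [b]) with hT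
    have vCUR : CUR T = encodeNat M := by simp [CUR, hT]
    have vGUARD : (valGeTwoFn ∘ CUR) T = [decide (2 ≤ M)] := by
      rw [Function.comp_apply, vCUR]; simp [valGeTwoFn]
    have vSEC : SEC T = (if 2 ≤ M then
        boolPair (encodeNat (M / M.minFac)) [b && !decide (M % (M.minFac * M.minFac) = 0)]
        else boolPair (encodeNat M) [b]) := by
      by_cases hM : 2 ≤ M
      · rw [if_pos hM]
        simp only [SEC]
        rw [iteFn_apply_true (by rw [vGUARD, decide_eq_true hM]), Function.comp_apply]
        have vU : U T = boolPair T (encodeNat M.minFac) := by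
          simp only [U, fanoutFn_apply, Function.comp_apply, vCUR, hmfval M hM]
        rw [vU]
        have vCUR' : CUR' (boolPair T (encodeNat M.minFac)) = encodeNat M := by
          simp only [CUR', Function.comp_apply, fstF_boolPair, vCUR]
        have vFLG : (FLG ∘ fstF) (boolPair T (encodeNat M.minFac)) = [b] := by
          simp [FLG, hT]
        have vDIV : DIVTEST (boolPair T (encodeNat M.minFac)) =
            [decide (M % (M.minFac * M.minFac) = 0)] := by
          simp only [DIVTEST, Function.comp_apply, fanoutFn_apply, vCUR', sndF_boolPair, prodFn_boolPair,
            bitsToNat_encodeNat, remFn_boolPair, isNilFn, encodeNat_eq_nil_iff]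
        have vNEWFLG : NEWFLG (boolPair T (encodeNat M.minFac)) =
            [b && !decide (M % (M.minFac * M.minFac) = 0)] := andFn_apply vFLG (notFn_apply vDIV)
        have vNEWCUR : NEWCUR (boolPair T (encodeNat M.minFac)) = encodeNat (M / M.minFac) := by
          simp only [NEWCUR, Function.comp_apply, fanoutFn_apply, vCUR', sndF_boolPair, divFn_boolPair,
            bitsToNat_encodeNat]
        simp only [POST, fanoutFn_apply, vNEWFLG, vNEWCUR]
      · rw [if_neg hM]
        simp only [SEC]
        rw [iteFn_apply_false (by rw [vGUARD, decide_eq_false hM]), hT, sndF_boolPair]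
    -- clipping is a no-op (`M / p ≤ M ≤ N`)
    have hlen : (SEC T).length ≤ 2 * (encodeNat N).length + 3 := by
      rw [vSEC]
      split_ifs
      · rw [length_boolPair]
        have := length_encodeNat_mono ((Nat.div_le_self M M.minFac).trans hMN)
        simp only [List.length_singleton]; omega
      · rw [length_boolPair]
        have := length_encodeNat_mono hMN
        simp only [List.length_singleton]; omega
    have vCLIP : CLIP T = SEC T := by
      simp only [CLIP, Function.comp_apply, fanoutFn_apply, takeFn_boolPair, polyFn_apply,
        List.length_replicate, eval_add, eval_mul, eval_ofNat, eval_X, hT, fstF_boolPair]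
      rw [← hT]
      exact List.take_of_length_le hlen
    simp only [F, fanoutFn_apply, hT, fstF_boolPair]
    rw [← hT, vCLIP, vSEC]
  -- the clocked iteration, initialisation and output
  have hITER : AdPres FACT (fun z => F^[(X + 1 : Polynomial ℕ).eval (fstF z).length] z) :=
    AdPres.iterate_of_growth hF 5 hfst hgrowth (X + 1)
  let INIT : List Bool → List Bool := fanoutFn (fun w => w) (fanoutFn (fun w => w) (fun _ => [true]))
  have hINIT : INIT ∈ FP :=
    fanoutFn_mem_FP (PolyTimeComputable.id _) (fanoutFn_mem_FP (PolyTimeComputable.id _) (const_mem_FP _))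
  refine ⟨FLG ∘ (fun z => F^[(X + 1 : Polynomial ℕ).eval (fstF z).length] z) ∘ INIT,
    AdPres.FP_comp (AdPres.comp_FP hITER hINIT) hFLG, fun N hN => ?_⟩
  have hstart : INIT (encodeNat N) = boolPair (encodeNat N) (boolPair (encodeNat N) [true]) := by
    simp [INIT]
  simp only [Function.comp_apply, hstart, fstF_boolPair, eval_add, eval_X, eval_one]
  obtain ⟨M, b, hk, h1, -, hiff, hbound⟩ :=
    peel_invariant F (encodeNat N) hN
      (fun M b hM hMN => by rw [hround N M b hMN, if_pos hM])
      (fun M b hM => by rw [hround N M b (by omega), if_neg (by omega)]) ((encodeNat N).length + 1)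
  rw [hk]
  simp only [FLG, Function.comp_apply, sndF_boolPair]
  have hM1 : M = 1 := peel_final h1 hbound
  rw [hM1] at hiff
  have hiff' : Squarefree N ↔ b = true := by rw [hiff]; simp
  by_cases hs : Squarefree N
  · rw [decide_eq_true hs, hiff'.1 hs]
  · rw [decide_eq_false hs]
    cases b
    · rfl
    · exact absurd (hiff'.2 rfl) hs

/-! ### `SQF ≤ᵀₚ FACT`: the language form -/

/-- **Squarefreeness testing is a bounded adaptive reduction to `FACT`**: `SQF = adLang Q q D FACT` for
some query generator `Q ∈ FP`, round budget `q` and final test `D ∈ P` (the presented program of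
`exists_squarefree_adPres`, guarded by "the input is a nonempty canonical numeral"). [folklore] -/
theorem exists_adLang_eq_squarefree : ∃ (Q : List Bool → List Bool) (q : Polynomial ℕ) (D : Language Bool),
    Q ∈ FP ∧ D ∈ Classes.P ∧
      adLang Q q D FACT = encodingNatBool.toLanguage {m : ℕ | Squarefree m} := by
  obtain ⟨sq, ⟨Q, G, q, hQ, hG, heq⟩, hval⟩ := exists_squarefree_adPres
  let g : List Bool → List Bool :=
    andFn (notFn (lastFalseF ∘ fstF)) (andFn (notFn (isNilFn ∘ fstF)) (isTrue1Fn ∘ G))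
  have hg : g ∈ FP := andFn_mem_FP (notFn_mem_FP (comp_mem_FP lastFalseF_mem_FP fstF_mem_FP))
    (andFn_mem_FP (notFn_mem_FP (comp_mem_FP isNilFn_mem_FP fstF_mem_FP)) (comp_mem_FP isTrue1Fn_mem_FP hG))
  have h1 : OneBit g := oneBit_andFn (oneBit_notFn (oneBit_lastFalseF.comp _))
    (oneBit_andFn (oneBit_notFn (oneBit_isNilFn.comp _)) (oneBit_isTrue1Fn.comp _))
  have gval : ∀ x y : List Bool, g (boolPair x y) =
      [!decide (x.getLast? = some false) && (!decide (x = []) && decide (G (boolPair x y) = [true]))] := by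
    intro x y
    simp only [g]
    rw [andFn_apply (notFn_apply (by rw [Function.comp_apply, fstF_boolPair, lastFalseF_apply]))
      (andFn_apply (notFn_apply (by rw [Function.comp_apply, fstF_boolPair]; rfl))
        (by rw [Function.comp_apply, isTrue1Fn_apply]))]
  refine ⟨Q, q, {w | g w = [true]}, hQ, mem_P_of_boolValued hg (fun z => ?_), ?_⟩
  · obtain ⟨b, hb⟩ := h1 z
    cases b
    · exact Or.inr hb
    · exact Or.inl hb
  · ext x
    change g (boolPair x (adBits Q FACT x (q.eval x.length))) = [true] ↔ _
    rw [gval, ← heq x]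
    simp only [List.cons.injEq, and_true, Bool.and_eq_true, Bool.not_eq_true', decide_eq_false_iff_not,
      decide_eq_true_eq]
    constructor
    · rintro ⟨hlast, hnil, hsq⟩
      -- `x` is a nonempty canonical numeral `bin N`, `N ≥ 1`
      have hcan : IsCanonicalNum x := by
        unfold IsCanonicalNum
        cases hx : x.getLast? with
        | none => exact Or.inl (List.getLast?_eq_none_iff.1 hx)
        | some c =>
          cases c
          · exact absurd hx hlast
          · exact Or.inr rfl
      have hx : encodeNat (decodeNat x) = x := encodeNat_decodeNat hcan
      have hN : 1 ≤ decodeNat x := by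
        rcases Nat.eq_zero_or_pos (decodeNat x) with h | h
        · rw [h] at hx; exact absurd hx.symm hnil
        · exact h
      rw [← hx, hval _ hN] at hsq
      simp only [List.cons.injEq, and_true, decide_eq_true_eq] at hsq
      rw [← hx]
      exact (encodingNatBool.mem_toLanguage_iff _ _).2 hsq
    · rintro ⟨N, hN, rfl⟩
      change Squarefree N at hN
      have hN1 : 1 ≤ N := Nat.pos_of_ne_zero (fun h => by rw [h] at hN; exact not_squarefree_zero hN)
      show ¬ (encodeNat N).getLast? = some false ∧ ¬ encodeNat N = [] ∧ sq (encodeNat N) = [true]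
      refine ⟨?_, ?_, ?_⟩
      · rcases isCanonicalNum_encodeNat N with h | h
        · rw [h]; simp
        · rw [h]; simp
      · rw [encodeNat_eq_nil_iff]; omega
      · rw [hval N hN1, decide_eq_true hN]

/-- **`SQUAREFREES ≤ᵀₚ FACT`** (polynomial-time Turing reducibility, the tree's `P^{FACT}` form).
[folklore] -/
theorem squarefree_polyTimeTuringReducible_FACT :
    PolyTimeTuringReducible (encodingNatBool.toLanguage {m : ℕ | Squarefree m}) FACT := by
  obtain ⟨Q, q, D, hQ, hD, heq⟩ := exists_adLang_eq_squarefree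
  rw [← heq]
  exact adLang_mem_PRel hQ hD FACT

/-- **`FACT ∈ P/poly → SQF ∈ P/poly`** (`P/poly` is closed under polynomial-time Turing reductions).
[folklore] -/
theorem squarefree_mem_PPoly_of_FACT_mem_PPoly (h : FACT ∈ PPoly) :
    encodingNatBool.toLanguage {m : ℕ | Squarefree m} ∈ PPoly :=
  mem_PPoly_of_polyTimeTuringReducible squarefree_polyTimeTuringReducible_FACT h

/-- **`FACT ∈ BPP → SQF ∈ BPP`** (`P^{BPP} = BPP` for bounded adaptive reductions). [folklore] -/
theorem squarefree_mem_BPP_of_FACT_mem_BPP (h : FACT ∈ BPP) :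
    encodingNatBool.toLanguage {m : ℕ | Squarefree m} ∈ BPP := by
  obtain ⟨Q, q, D, hQ, hD, heq⟩ := exists_adLang_eq_squarefree
  rw [← heq]
  exact AdBPPSim.adLang_mem_BPP h hQ q hD

/-! ### The squarefree apexes sit above the factoring theses -/

/-- **The apex of line `Sketch` implies the non-uniform factoring assumption**: `SQF ∉ P/poly →
FACT ∉ P/poly`, i.e. route CircuitLB's crux `ClbFactNotPpoly`, by name. [folklore] -/
theorem clbFactNotPpoly_of_squarefree_not_mem_PPoly
    (h : encodingNatBool.toLanguage {m : ℕ | Squarefree m} ∉ PPoly) :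
    Summit.QuantumAdvantage.QuantumAdvantage.Theses.CircuitLB.ClbFactNotPpoly :=
  fun hF => h (squarefree_mem_PPoly_of_FACT_mem_PPoly hF)

/-- **The uniform squarefree apex (crux 14864's `stub_sqfreeNotBPP`) implies route Shor's thesis**:
`SQF ∉ BPP → FACT ∉ BPP` (`ShorThesis`), by name. [folklore] -/
theorem shorThesis_of_squarefree_not_mem_BPP
    (h : encodingNatBool.toLanguage {m : ℕ | Squarefree m} ∉ BPP) :
    Summit.QuantumAdvantage.QuantumAdvantage.Theses.Shor.ShorThesis :=
  fun hF => h (squarefree_mem_BPP_of_FACT_mem_BPP hF)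

/-- … and the apex of line `Sketch` implies BOTH (`BPP ⊆ P/poly`). [folklore] -/
theorem shorThesis_of_squarefree_not_mem_PPoly
    (h : encodingNatBool.toLanguage {m : ℕ | Squarefree m} ∉ PPoly) :
    Summit.QuantumAdvantage.QuantumAdvantage.Theses.Shor.ShorThesis :=
  shorThesis_of_squarefree_not_mem_BPP fun hB => h (BPP_subset_PPoly_holds hB)

end Summit.QuantumAdvantage.QuantumAdvantage.Theorems.IqThreeNotPPoly

end
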